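import Summits.QuantumFields.YangMills.Theorems.WeakCouplingRatesHarmonicInteriorKernel
import Summits.QuantumFields.YangMills.Theorems.WeakCouplingRatesBoxDecay
import Literature.Probability.LatticeModels.LatticeGreenAsymptotics
import HarnessLib

/-!
# Crux `UVSeamRec` (stmt-QuantumFields-20043), free-field calibration of (RM), file 1/3: a radius-averaged reproducing kernel on `ℤ⁴`
# with `ℓ²`-norm `O(r⁻⁴)`, and the interior FLUX representation of the centre gradient of a lattice-harmonic function

Helper file (`--supports stmt-QuantumFields-20043`) of the seam seat `ym-20043-seam-s2` (gen 3); theorems + one plumbing definition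
(`avgKernel`, no route content).  WHY: the registered v5(α) stub `BirthV5A.stub_responseMomentsOdd6 : UV → (RM)` (joint exponential RESPONSE
MOMENTS over `2R+4`-separated cube families) has the documented (β-cl) architecture (p548409) resting on an extensive sub-Gaussian law in LINEAR
sources, whose `Σ tᵢ²`-structure is an OPERATOR-NORM statement for the response carriers of separated cubes (ceilings-p2 note #54 §2: the `ℓ¹`
budget diverges like `log` in `d = 4`).  This series PROVES that architecture in the free field (lattice GFF of `ℤ⁴`, tree `IsDiscreteGFF`); the
present file is the deterministic core: for `u` harmonic on the sup-box of radius `4r − 2`,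
`u(eⱼ) − u(0) = Σ_z avgKernel r z · (u(z + eⱼ) − u(z))` with `Σ_z (avgKernel r z)² ≤ K/r⁴` — the centre gradient of the harmonic extension is the
pairing of `∇u` with an INTERIOR flux of energy `O(r⁻⁴)`.  The tree's kernel `kernel₁ r` (`…WeakCouplingRatesHarmonicInteriorKernel`,
piecewise-linear cut-off) alone has `ℓ²`-norm² `≍ r⁻³` (values `O(r⁻³)` on the kink hyperplanes `|z_i| ∈ {r, 2r}`); averaging over the radii
`r' ∈ [r, 2r)` spreads the kinks and restores `O(r⁻⁴)`.
§1 sup-norm bounds on `gHalf = G/2` in `d = 4`; §2 `kernel₁ r 0 z` rearranged, support, pointwise bound `A/r⁴ + (B/r³)·#{i : |z_i| ∈ {r,2r}}`;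
§3 `avgKernel`: `|avgKernel r z| ≤ A/r⁴`, support in `sbox (4r − 2)`, `Σ_z avgKernel² ≤ K/r⁴`; §4 reproducing identity and gradient representation.
No sorry, standard axioms.  HONEST FRAMING: lattice potential theory; a CALIBRATION tool for one OPEN binder of a CONDITIONAL chain; nothing of
E0′, not a gap, not Clay.  References: Lawler–Limic, *Random Walk: A Modern Introduction* (2010), Thm. 4.3.1 / 6.3.8.
-/

set_option autoImplicit false

noncomputable section

open Finset Filter Topology
open Literature.Probability.LatticeModels
open Literature.MathematicalPhysics.QuantumFieldTheory.LatticeForm (e)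
open Summit.QuantumFields.YangMills.Theorems.WeakCouplingRates
open Summit.QuantumFields.YangMills.Theorems.WeakCouplingRates.HarmonicInterior

namespace Summit.QuantumFields.YangMills.Cruxes.UVSeamRec.GaussianCalibration

/-! ## §1 Sup-norm bounds on `gHalf = G/2` in `d = 4` -/

/-- **Decay of the Green kernel of `ℤ⁴`**: `|gHalf x| ≤ K/‖x‖²` for `x ≠ 0` (sup norm), from the tree's asymptotics
`G(x) = a₄|x|₂⁻² + O(|x|₂⁻⁴)` and `|x|₂ ≥ ‖x‖∞ ≥ 1`. [cite: LawlerLimic2010, Theorem 4.3.1] -/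
theorem exists_gHalf_le_inv_norm_sq : ∃ K : ℝ, 0 ≤ K ∧ ∀ x : Site 4, x ≠ 0 → |gHalf x| ≤ K / ‖x‖ ^ 2 := by
  obtain ⟨K₀, hK⟩ := latticeGreen_asymptotics (d := 4) (by norm_num)
  set a : ℝ := Real.Gamma (((4 : ℕ) : ℝ) / 2 - 1) / (2 * Real.pi ^ (((4 : ℕ) : ℝ) / 2)) with ha
  set K : ℝ := max K₀ 0 with hKdef
  have hK0 : 0 ≤ K := le_max_right _ _
  refine ⟨(|a| + K) / 2, by positivity, fun x hx => ?_⟩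
  set S : ℝ := Real.sqrt (∑ i, ((x i : ℤ) : ℝ) ^ 2) with hS
  have h : |latticeGreen x - a * S ^ (2 - ((4 : ℕ) : ℝ))| ≤ K * S ^ (-((4 : ℕ) : ℝ)) :=
    (hK x hx).trans (mul_le_mul_of_nonneg_right (le_max_left _ _) (Real.rpow_nonneg (Real.sqrt_nonneg _) _))
  have h2 : S ^ (2 - ((4 : ℕ) : ℝ)) ≤ 1 / ‖x‖ ^ 2 := sqrt_rpow_le_inv_norm_pow hx 2 (by norm_num)
  have h4 : S ^ (-((4 : ℕ) : ℝ)) ≤ 1 / ‖x‖ ^ 4 := sqrt_rpow_le_inv_norm_pow hx 4 (by norm_num)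
  have hx1 : 1 ≤ ‖x‖ := one_le_norm_of_ne_zero hx
  have h4' : 1 / ‖x‖ ^ 4 ≤ 1 / ‖x‖ ^ 2 := by
    rw [one_div_le_one_div (by positivity) (by positivity)]
    exact pow_le_pow_right₀ hx1 (by norm_num)
  have hS0 : 0 ≤ S ^ (2 - ((4 : ℕ) : ℝ)) := Real.rpow_nonneg (Real.sqrt_nonneg _) _
  have hG : |latticeGreen x| ≤ |a| * (1 / ‖x‖ ^ 2) + K * (1 / ‖x‖ ^ 2) := by
    have e1 : latticeGreen x = (latticeGreen x - a * S ^ (2 - ((4 : ℕ) : ℝ))) + a * S ^ (2 - ((4 : ℕ) : ℝ)) := by ring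
    rw [e1]
    refine (abs_add_le _ _).trans ?_
    rw [add_comm]
    refine add_le_add ?_ (h.trans ((mul_le_mul_of_nonneg_left h4 hK0).trans (mul_le_mul_of_nonneg_left h4' hK0)))
    rw [abs_mul, abs_of_nonneg hS0]
    exact mul_le_mul_of_nonneg_left h2 (abs_nonneg _)
  unfold gHalf
  rw [abs_div, abs_two]
  have : |a| * (1 / ‖x‖ ^ 2) + K * (1 / ‖x‖ ^ 2) = (|a| + K) / ‖x‖ ^ 2 := by ring
  rw [this] at hG
  calc |latticeGreen x| / 2 ≤ ((|a| + K) / ‖x‖ ^ 2) / 2 := by gcongr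
    _ = (|a| + K) / 2 / ‖x‖ ^ 2 := by ring

/-- A uniform bound `|gHalf x| ≤ T` on all of `ℤ⁴`. [folklore] -/
theorem exists_gHalf_le : ∃ T : ℝ, 0 ≤ T ∧ ∀ x : Site 4, |gHalf x| ≤ T := by
  obtain ⟨K, hK0, hK⟩ := exists_gHalf_le_inv_norm_sq
  refine ⟨|gHalf (0 : Site 4)| + K, by positivity, fun x => ?_⟩
  by_cases hx : x = 0
  · subst hx; linarith
  · have h1 : 1 ≤ ‖x‖ := one_le_norm_of_ne_zero hx
    have h2 : K / ‖x‖ ^ 2 ≤ K := div_le_self hK0 (one_le_pow₀ h1)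
    linarith [hK x hx, abs_nonneg (gHalf (0 : Site 4))]

/-- **Two-step gradient bound**: `|gHalf (x − eᵢ) − gHalf (x + eᵢ)| ≤ K/‖x‖³` for `x ≠ 0`. [cite: LawlerLimic2010, Theorem 4.3.1] -/
theorem exists_gHalf_twoStep_le : ∃ K : ℝ, 0 ≤ K ∧ ∀ x : Site 4, x ≠ 0 → ∀ i : Fin 4,
    |gHalf (x - e i) - gHalf (x + e i)| ≤ K / ‖x‖ ^ 3 := by
  obtain ⟨K, hK0, hK⟩ := exists_latticeGreen_grad_bound
  refine ⟨K, hK0, fun x hx i => ?_⟩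
  obtain ⟨h1, h2⟩ := hK x hx i
  unfold gHalf
  have e1 : latticeGreen (x - e i) / 2 - latticeGreen (x + e i) / 2 =
      ((latticeGreen (x - e i) - latticeGreen x) - (latticeGreen (x + e i) - latticeGreen x)) / 2 := by ring
  rw [e1, abs_div, abs_two]
  calc |latticeGreen (x - e i) - latticeGreen x - (latticeGreen (x + e i) - latticeGreen x)| / 2
      ≤ (K / ‖x‖ ^ 3 + K / ‖x‖ ^ 3) / 2 := by gcongr; exact (abs_sub _ _).trans (add_le_add h2 h1)
    _ = K / ‖x‖ ^ 3 := by ring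

/-! ## §2 The tree's representation kernel at the centre: rearrangement, support, pointwise bound -/

/-- Rearrangement of the tree's kernel at the centre `x = 0`:
`kernel₁ r 0 z = Σ_i [dminus r i z · (gHalf(−z−eᵢ) − gHalf(−z+eᵢ)) + dtwo r i z · gHalf(−z−eᵢ)]`
(a `(1/r)`-Lipschitz factor times a two-step DIFFERENCE of the Green kernel, plus a second difference of the cut-off times the kernel). [folklore] -/
theorem kernel₁_zero_eq {d : ℕ} (r : ℕ) (z : Site d) :
    kernel₁ r 0 z = ∑ i, (dminus r i z * (gHalf (-z - e i) - gHalf (-z + e i)) + dtwo r i z * gHalf (-z - e i)) := by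
  unfold kernel₁
  refine Finset.sum_congr rfl fun i _ => ?_
  rw [dtwo_eq, zero_sub]
  ring

/-- The kernel `kernel₁ r x ·` vanishes off the sup-box of radius `2r`. [folklore] -/
theorem kernel₁_eq_zero_of_not_mem {d : ℕ} {r : ℕ} (x : Site d) {z : Site d} (hz : z ∉ sbox (2 * r)) :
    kernel₁ r x z = 0 := by
  unfold kernel₁
  exact Finset.sum_eq_zero fun i _ => by rw [dplus_eq_zero_of_not_mem hz, dminus_eq_zero_of_not_mem hz]; ring

/-- A uniform bound: `|kernel₁ r 0 z| ≤ 16·T` with `T` the sup of `|gHalf|` (all `r ≥ 1`, all `z`). [folklore] -/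
theorem exists_abs_kernel₁_zero_le_const : ∃ T : ℝ, 0 ≤ T ∧ ∀ r : ℕ, 0 < r → ∀ z : Site 4, |kernel₁ r 0 z| ≤ T := by
  obtain ⟨T, hT0, hT⟩ := exists_gHalf_le
  refine ⟨16 * T, by positivity, fun r hr z => ?_⟩
  rw [kernel₁_zero_eq]
  have hterm : ∀ i : Fin 4, |dminus r i z * (gHalf (-z - e i) - gHalf (-z + e i)) + dtwo r i z * gHalf (-z - e i)| ≤ 4 * T := by
    intro i
    have h1 : |dminus r i z| ≤ 1 := (abs_dminus_le hr i z).trans (by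
      rw [div_le_one (by exact_mod_cast hr)]; exact_mod_cast Nat.one_le_iff_ne_zero.2 (by omega))
    have h2 : |dtwo r i z| ≤ 2 := (abs_dtwo_le hr i z).trans (by
      rw [div_le_iff₀ (by exact_mod_cast hr)]
      have : (1 : ℝ) ≤ r := by exact_mod_cast Nat.one_le_iff_ne_zero.2 (by omega)
      linarith)
    have h3 : |gHalf (-z - e i) - gHalf (-z + e i)| ≤ 2 * T :=
      (abs_sub _ _).trans (by linarith [hT (-z - e i), hT (-z + e i)])
    calc |dminus r i z * (gHalf (-z - e i) - gHalf (-z + e i)) + dtwo r i z * gHalf (-z - e i)|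
        ≤ |dminus r i z| * |gHalf (-z - e i) - gHalf (-z + e i)| + |dtwo r i z| * |gHalf (-z - e i)| := by
          refine (abs_add_le _ _).trans ?_; rw [abs_mul, abs_mul]
      _ ≤ 1 * (2 * T) + 2 * T := by
          gcongr
          · exact hT _
      _ = 4 * T := by ring
  calc |∑ i : Fin 4, (dminus r i z * (gHalf (-z - e i) - gHalf (-z + e i)) + dtwo r i z * gHalf (-z - e i))|
      ≤ ∑ i : Fin 4, |dminus r i z * (gHalf (-z - e i) - gHalf (-z + e i)) + dtwo r i z * gHalf (-z - e i)| :=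
        Finset.abs_sum_le_sum_abs _ _
    _ ≤ ∑ _i : Fin 4, 4 * T := Finset.sum_le_sum fun i _ => hterm i
    _ = 16 * T := by simp; ring

/-- **Pointwise bound on the representation kernel** (`d = 4`, `r ≥ 2`): `|kernel₁ r 0 z| ≤ A/r⁴ + (B/r³)·#{i : |z_i| ∈ {r, 2r}}` —
`O(r⁻⁴)` off the kink hyperplanes of the piecewise-linear cut-off and `O(r⁻³)` on them. [folklore] -/
theorem exists_abs_kernel₁_zero_le : ∃ A B : ℝ, 0 ≤ A ∧ 0 ≤ B ∧ ∀ r : ℕ, 2 ≤ r → ∀ z : Site 4,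
    |kernel₁ r 0 z| ≤ A / (r : ℝ) ^ 4 +
      B / (r : ℝ) ^ 3 * #{i : Fin 4 | |z i| = r ∨ |z i| = 2 * (r : ℤ)} := by
  obtain ⟨Kg, hKg0, hKg⟩ := exists_gHalf_twoStep_le
  obtain ⟨K₀, hK₀0, hK₀⟩ := exists_gHalf_le_inv_norm_sq
  refine ⟨4 * Kg, 8 * K₀, by positivity, by positivity, fun r hr z => ?_⟩
  have hr0 : 0 < r := by omega
  have hrpos : (0 : ℝ) < r := by exact_mod_cast hr0
  have hr2 : (2 : ℝ) ≤ r := by exact_mod_cast hr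
  rw [kernel₁_zero_eq]
  have hterm : ∀ i : Fin 4, |dminus r i z * (gHalf (-z - e i) - gHalf (-z + e i)) + dtwo r i z * gHalf (-z - e i)|
      ≤ Kg / (r : ℝ) ^ 4 + (if |z i| = r ∨ |z i| = 2 * (r : ℤ) then 8 * K₀ / (r : ℝ) ^ 3 else 0) := by
    intro i
    refine (abs_add_le _ _).trans (add_le_add ?_ ?_)
    · by_cases hdm : dminus r i z = 0
      · rw [hdm, zero_mul, abs_zero]; positivity
      · have hzi : (r : ℤ) ≤ |z i| := by
          by_contra hlt
          exact hdm (dminus_eq_zero hr0 (by omega))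
        have hz0 : -z ≠ 0 := by
          intro h
          have : z i = 0 := by have := congrFun (neg_eq_zero.1 h) i; simpa using this
          rw [this, abs_zero] at hzi
          have : (0 : ℤ) < r := by exact_mod_cast hr0
          omega
        have hnorm : (r : ℝ) ≤ ‖-z‖ := by
          rw [norm_neg]
          have h' : ((r : ℤ) : ℝ) ≤ (((|z i| : ℤ)) : ℝ) := by exact_mod_cast hzi
          rw [Int.cast_abs] at h'
          push_cast at h'
          exact h'.trans (abs_coord_le_norm z i)
        rw [abs_mul]
        calc |dminus r i z| * |gHalf (-z - e i) - gHalf (-z + e i)| ≤ (1 / r) * (Kg / ‖-z‖ ^ 3) :=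
              mul_le_mul (abs_dminus_le hr0 i z) (hKg (-z) hz0 i) (abs_nonneg _) (by positivity)
          _ ≤ (1 / r) * (Kg / (r : ℝ) ^ 3) := by gcongr
          _ = Kg / (r : ℝ) ^ 4 := by ring
    · by_cases hkink : |z i| = r ∨ |z i| = 2 * (r : ℤ)
      · rw [if_pos hkink]
        have hzi : (r : ℤ) ≤ |z i| := by rcases hkink with h | h <;> omega
        have hw : (r : ℝ) - 1 ≤ ‖-z - e i‖ := by
          have h1 : |(((-z - e i) i : ℤ) : ℝ)| ≤ ‖-z - e i‖ := abs_coord_le_norm (-z - e i) i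
          rw [sub_e_apply_same, Pi.neg_apply] at h1
          have h2 : ((r : ℤ) : ℝ) - 1 ≤ |(((-z i - 1 : ℤ)) : ℝ)| := by
            have : (r : ℤ) - 1 ≤ |-z i - 1| := by
              rcases abs_cases (z i) with ⟨h, _⟩ | ⟨h, _⟩ <;>
                rcases abs_cases (-z i - 1) with ⟨h', _⟩ | ⟨h', _⟩ <;> omega
            have := (Int.cast_le (R := ℝ)).2 this
            rw [Int.cast_abs] at this
            push_cast at this ⊢
            exact this
          push_cast at h1 h2
          exact h2.trans h1
        have hne : -z - e i ≠ 0 := by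
          intro h
          rw [h, norm_zero] at hw
          linarith
        have hw2 : (r : ℝ) / 2 ≤ ‖-z - e i‖ := by linarith
        rw [abs_mul]
        calc |dtwo r i z| * |gHalf (-z - e i)| ≤ (2 / r) * (K₀ / ‖-z - e i‖ ^ 2) :=
              mul_le_mul (abs_dtwo_le hr0 i z) (hK₀ _ hne) (abs_nonneg _) (by positivity)
          _ ≤ (2 / r) * (K₀ / ((r : ℝ) / 2) ^ 2) := by gcongr
          _ = 8 * K₀ / (r : ℝ) ^ 3 := by field_simp; ring
      · rw [if_neg hkink, dtwo_eq_zero hr0 (fun h => hkink (Or.inl h)) (fun h => hkink (Or.inr h)), zero_mul,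
          abs_zero]
  calc |∑ i : Fin 4, (dminus r i z * (gHalf (-z - e i) - gHalf (-z + e i)) + dtwo r i z * gHalf (-z - e i))|
      ≤ ∑ i : Fin 4, |dminus r i z * (gHalf (-z - e i) - gHalf (-z + e i)) + dtwo r i z * gHalf (-z - e i)| :=
        Finset.abs_sum_le_sum_abs _ _
    _ ≤ ∑ i : Fin 4, (Kg / (r : ℝ) ^ 4 + (if |z i| = r ∨ |z i| = 2 * (r : ℤ) then 8 * K₀ / (r : ℝ) ^ 3 else 0)) :=
        Finset.sum_le_sum fun i _ => hterm i
    _ = 4 * Kg / (r : ℝ) ^ 4 + 8 * K₀ / (r : ℝ) ^ 3 * #{i : Fin 4 | |z i| = r ∨ |z i| = 2 * (r : ℤ)} := by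
        rw [Finset.sum_add_distrib, Finset.sum_const, Finset.card_univ, Fintype.card_fin, nsmul_eq_mul,
          ← Finset.sum_filter, Finset.sum_const, nsmul_eq_mul]
        push_cast
        ring

/-! ## §3 The radius-averaged kernel -/

/-- **The radius-averaged representation kernel** `avgKernel r z = r⁻¹ Σ_{r' ∈ [r, 2r)} kernel₁ r' 0 z` on `ℤ⁴`
(plumbing object of the free-field calibration; averaging the tree's kernel over radii spreads its kink layers). -/
def avgKernel (r : ℕ) (z : Site 4) : ℝ := (∑ r' ∈ Finset.Ico r (2 * r), kernel₁ r' 0 z) / r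

/-- `avgKernel r` vanishes off the sup-box of radius `4r − 2` (each `kernel₁ r'`, `r' < 2r`, lives on `sbox (2r')`). [folklore] -/
theorem avgKernel_eq_zero_of_not_mem {r : ℕ} {z : Site 4} (hz : z ∉ sbox (4 * r - 2)) : avgKernel r z = 0 := by
  unfold avgKernel
  rw [Finset.sum_eq_zero fun r' hr' => ?_, zero_div]
  refine kernel₁_eq_zero_of_not_mem 0 fun h => hz ?_
  rw [Finset.mem_Ico] at hr'
  rw [mem_sbox] at h ⊢
  intro k
  have := h k
  push_cast at this ⊢
  omega

/-- `avgKernel r` vanishes off the sup-box of radius `4r`. [folklore] -/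
theorem avgKernel_eq_zero_of_not_mem' {r : ℕ} {z : Site 4} (hz : z ∉ sbox (4 * r)) : avgKernel r z = 0 := by
  refine avgKernel_eq_zero_of_not_mem fun h => hz ?_
  rw [mem_sbox] at h ⊢
  intro k; have := h k; push_cast at this ⊢; omega

/-- For each coordinate, at most two radii `r' ∈ [r, 2r)` have a kink at `|z_i|` (`|z_i| = r'` or `|z_i| = 2r'`). [folklore] -/
theorem card_filter_kink_radii_le (r : ℕ) (z : Site 4) (i : Fin 4) :
    #{r' ∈ Finset.Ico r (2 * r) | |z i| = ((r' : ℕ) : ℤ) ∨ |z i| = 2 * ((r' : ℕ) : ℤ)} ≤ 2 := by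
  have h1 : #{r' ∈ Finset.Ico r (2 * r) | |z i| = ((r' : ℕ) : ℤ)} ≤ 1 :=
    Finset.card_le_one.2 fun a ha b hb => by
      rw [Finset.mem_filter] at ha hb
      have : (a : ℤ) = b := ha.2.symm.trans hb.2
      exact_mod_cast this
  have h2 : #{r' ∈ Finset.Ico r (2 * r) | |z i| = 2 * ((r' : ℕ) : ℤ)} ≤ 1 :=
    Finset.card_le_one.2 fun a ha b hb => by
      rw [Finset.mem_filter] at ha hb
      have : (2 : ℤ) * a = 2 * b := ha.2.symm.trans hb.2
      omega
  have hsub : {r' ∈ Finset.Ico r (2 * r) | |z i| = ((r' : ℕ) : ℤ) ∨ |z i| = 2 * ((r' : ℕ) : ℤ)} ⊆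
      {r' ∈ Finset.Ico r (2 * r) | |z i| = ((r' : ℕ) : ℤ)} ∪ {r' ∈ Finset.Ico r (2 * r) | |z i| = 2 * ((r' : ℕ) : ℤ)} := by
    intro a ha
    rw [Finset.mem_filter] at ha
    rw [Finset.mem_union, Finset.mem_filter, Finset.mem_filter]
    tauto
  exact (Finset.card_le_card hsub).trans ((Finset.card_union_le _ _).trans (by omega))

/-- **Pointwise bound on the averaged kernel**: `|avgKernel r z| ≤ A/r⁴` for all `r ≥ 1` and all `z` (`d = 4`). [folklore] -/
theorem exists_abs_avgKernel_le : ∃ A : ℝ, 0 ≤ A ∧ ∀ r : ℕ, 1 ≤ r → ∀ z : Site 4, |avgKernel r z| ≤ A / (r : ℝ) ^ 4 := by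
  obtain ⟨T, hT0, hT⟩ := exists_abs_kernel₁_zero_le_const
  obtain ⟨A, B, hA0, hB0, hAB⟩ := exists_abs_kernel₁_zero_le
  refine ⟨T + (A + 8 * B), by positivity, fun r hr z => ?_⟩
  have hrpos : (0 : ℝ) < r := by exact_mod_cast hr
  rcases Nat.lt_or_ge r 2 with hr1 | hr2
  · -- r = 1: the average is `kernel₁ 1 0 z`
    have hr1' : r = 1 := by omega
    subst hr1'
    have hI : Finset.Ico 1 (2 * 1) = {1} := by decide
    unfold avgKernel
    rw [hI, Finset.sum_singleton, Nat.cast_one, div_one, one_pow, div_one]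
    exact (hT 1 one_pos z).trans (by linarith [mul_nonneg (show (0:ℝ) ≤ 8 by norm_num) hB0])
  · -- r ≥ 2: termwise bounds and the kink count
    have hcardI : #(Finset.Ico r (2 * r)) = r := by rw [Nat.card_Ico]; omega
    have hkey : |∑ r' ∈ Finset.Ico r (2 * r), kernel₁ r' 0 z| ≤ (A + 8 * B) / (r : ℝ) ^ 3 := by
      have hterm : ∀ r' ∈ Finset.Ico r (2 * r), |kernel₁ r' 0 z| ≤
          A / (r : ℝ) ^ 4 + B / (r : ℝ) ^ 3 * #{i : Fin 4 | |z i| = r' ∨ |z i| = 2 * (r' : ℤ)} := by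
        intro r' hr'
        rw [Finset.mem_Ico] at hr'
        have hr'2 : 2 ≤ r' := hr2.trans hr'.1
        have hrr' : (r : ℝ) ≤ r' := by exact_mod_cast hr'.1
        refine (hAB r' hr'2 z).trans (add_le_add ?_ ?_)
        · exact div_le_div_of_nonneg_left hA0 (by positivity) (by gcongr)
        · exact mul_le_mul_of_nonneg_right (div_le_div_of_nonneg_left hB0 (by positivity) (by gcongr)) (by positivity)
      have hcount : ∑ r' ∈ Finset.Ico r (2 * r), (#{i : Fin 4 | |z i| = r' ∨ |z i| = 2 * (r' : ℤ)} : ℝ) ≤ 8 := by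
        have hswap : ∑ r' ∈ Finset.Ico r (2 * r), (#{i : Fin 4 | |z i| = r' ∨ |z i| = 2 * (r' : ℤ)} : ℝ) =
            ∑ i : Fin 4, (#{r' ∈ Finset.Ico r (2 * r) | |z i| = ((r' : ℕ) : ℤ) ∨ |z i| = 2 * ((r' : ℕ) : ℤ)} : ℝ) := by
          simp only [Finset.card_filter, Nat.cast_sum, Nat.cast_ite, Nat.cast_one, Nat.cast_zero]
          rw [Finset.sum_comm]
        rw [hswap]
        calc ∑ i : Fin 4, (#{r' ∈ Finset.Ico r (2 * r) | |z i| = ((r' : ℕ) : ℤ) ∨ |z i| = 2 * ((r' : ℕ) : ℤ)} : ℝ)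
            ≤ ∑ _i : Fin 4, (2 : ℝ) := Finset.sum_le_sum fun i _ => by exact_mod_cast card_filter_kink_radii_le r z i
          _ = 8 := by simp; norm_num
      calc |∑ r' ∈ Finset.Ico r (2 * r), kernel₁ r' 0 z| ≤ ∑ r' ∈ Finset.Ico r (2 * r), |kernel₁ r' 0 z| :=
            Finset.abs_sum_le_sum_abs _ _
        _ ≤ ∑ r' ∈ Finset.Ico r (2 * r),
              (A / (r : ℝ) ^ 4 + B / (r : ℝ) ^ 3 * #{i : Fin 4 | |z i| = r' ∨ |z i| = 2 * (r' : ℤ)}) :=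
            Finset.sum_le_sum hterm
        _ = r * (A / (r : ℝ) ^ 4) + B / (r : ℝ) ^ 3 *
              ∑ r' ∈ Finset.Ico r (2 * r), (#{i : Fin 4 | |z i| = r' ∨ |z i| = 2 * (r' : ℤ)} : ℝ) := by
            rw [Finset.sum_add_distrib, Finset.sum_const, hcardI, nsmul_eq_mul, Finset.mul_sum]
        _ ≤ r * (A / (r : ℝ) ^ 4) + B / (r : ℝ) ^ 3 * 8 := by gcongr
        _ = (A + 8 * B) / (r : ℝ) ^ 3 := by field_simp
    unfold avgKernel
    rw [abs_div, Nat.abs_cast, div_le_iff₀ hrpos]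
    refine hkey.trans ?_
    rw [div_mul_eq_mul_div, le_div_iff₀ (by positivity)]
    have : (A + 8 * B) / (r : ℝ) ^ 3 * (r : ℝ) ^ 4 = (A + 8 * B) * r := by field_simp
    rw [this]
    nlinarith [hT0, hrpos]

/-- **`ℓ²`-bound**: `Σ_{z ∈ S} (avgKernel r z)² ≤ K/r⁴` for every finite `S`, all `r ≥ 1` — the energy of the interior flux carrying the
centre gradient of a harmonic function is `O(r⁻⁴)` (the `R⁻⁴` law of the free-field response, in flux form). [folklore] -/
theorem exists_sum_avgKernel_sq_le : ∃ K : ℝ, 0 ≤ K ∧ ∀ r : ℕ, 1 ≤ r → ∀ S : Finset (Site 4),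
    ∑ z ∈ S, (avgKernel r z) ^ 2 ≤ K / (r : ℝ) ^ 4 := by
  obtain ⟨A, hA0, hA⟩ := exists_abs_avgKernel_le
  refine ⟨9 ^ 4 * A ^ 2, by positivity, fun r hr S => ?_⟩
  have hrpos : (0 : ℝ) < r := by exact_mod_cast hr
  have h1 : ∑ z ∈ S, (avgKernel r z) ^ 2 ≤ ∑ z ∈ S ∪ sbox (4 * r), (avgKernel r z) ^ 2 :=
    Finset.sum_le_sum_of_subset_of_nonneg Finset.subset_union_left fun z _ _ => sq_nonneg _
  have h2 : ∑ z ∈ S ∪ sbox (4 * r), (avgKernel r z) ^ 2 = ∑ z ∈ sbox (4 * r), (avgKernel r z) ^ 2 := by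
    symm
    refine Finset.sum_subset Finset.subset_union_right fun z _ hz => ?_
    rw [avgKernel_eq_zero_of_not_mem' hz]; ring
  have h3 : ∑ z ∈ sbox (4 * r), (avgKernel r z) ^ 2 ≤ ∑ _z ∈ sbox (d := 4) (4 * r), (A / (r : ℝ) ^ 4) ^ 2 :=
    Finset.sum_le_sum fun z _ => by
      rw [← sq_abs]
      exact pow_le_pow_left₀ (abs_nonneg _) (hA r hr z) 2
  rw [Finset.sum_const, card_sbox, nsmul_eq_mul] at h3
  refine h1.trans (h2.le.trans (h3.trans ?_))
  have hcard : (((2 * (4 * r) + 1) ^ 4 : ℕ) : ℝ) ≤ (9 * (r : ℝ)) ^ 4 := by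
    have : (1 : ℝ) ≤ r := by exact_mod_cast hr
    push_cast
    nlinarith [pow_le_pow_left₀ (by positivity : (0:ℝ) ≤ 2 * (4 * r) + 1) (by linarith : (2 : ℝ) * (4 * r) + 1 ≤ 9 * r) 4]
  calc (((2 * (4 * r) + 1) ^ 4 : ℕ) : ℝ) * (A / (r : ℝ) ^ 4) ^ 2 ≤ (9 * (r : ℝ)) ^ 4 * (A / (r : ℝ) ^ 4) ^ 2 := by
        gcongr
    _ = 9 ^ 4 * A ^ 2 / (r : ℝ) ^ 4 := by field_simp

/-! ## §4 The reproducing identity and the interior flux representation of the centre gradient -/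

/-- **Reproducing identity for the averaged kernel**: if `Δu = 0` at every site with all `|z_k| < 4r − 2` (`r ≥ 1`), then
`u(0) = Σ_{z ∈ sbox(4r)} u(z) · avgKernel r z`. [folklore] -/
theorem harmonic_eq_sum_avgKernel {r : ℕ} (hr : 0 < r) (u : Site 4 → ℝ)
    (hharm : ∀ z : Site 4, (∀ k, |z k| < 4 * (r : ℤ) - 2) → latticeLaplacianZd u z = 0) :
    u 0 = ∑ z ∈ sbox (4 * r), u z * avgKernel r z := by
  have hrep : ∀ r' ∈ Finset.Ico r (2 * r), u 0 = ∑ z ∈ sbox (4 * r), u z * kernel₁ r' 0 z := by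
    intro r' hr'
    rw [Finset.mem_Ico] at hr'
    have hr'0 : 0 < r' := by omega
    have h := harmonic_eq_sum_kernel (d := 4) (by norm_num) hr'0 u
      (fun z hz => hharm z fun k => by have := hz k; omega) 0 (fun k => by simp)
    rw [h]
    refine Finset.sum_subset (fun z hz => ?_) fun z _ hz => ?_
    · rw [mem_sbox] at hz ⊢
      intro k; have := hz k; push_cast at this ⊢; omega
    · rw [kernel₁_eq_zero_of_not_mem 0 fun h => hz ?_, mul_zero]
      rw [mem_sbox] at h ⊢
      intro k; have := h k; push_cast at this ⊢; omega
  have hcardI : #(Finset.Ico r (2 * r)) = r := by rw [Nat.card_Ico]; omega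
  have hrpos : (r : ℝ) ≠ 0 := by exact_mod_cast hr.ne'
  have hsum : (r : ℝ) * u 0 = ∑ r' ∈ Finset.Ico r (2 * r), ∑ z ∈ sbox (4 * r), u z * kernel₁ r' 0 z := by
    rw [Finset.sum_congr rfl fun r' hr' => (hrep r' hr').symm, Finset.sum_const, hcardI, nsmul_eq_mul]
  unfold avgKernel
  simp_rw [mul_div_assoc', ← Finset.sum_div, Finset.mul_sum]
  rw [Finset.sum_comm, ← hsum]
  field_simp

/-- **Interior flux representation of the centre gradient.**  If `Δu = 0` at every site with all `|z_k| ≤ 4r − 2` (`r ≥ 1`), then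
`u(eⱼ) − u(0) = Σ_{z ∈ sbox(4r)} avgKernel r z · (u(z + eⱼ) − u(z))`: the centre gradient of a harmonic function is the pairing of its
gradient field with the flux `avgKernel r` placed on the `j`-edges of the box, of energy `O(r⁻⁴)` (`exists_sum_avgKernel_sq_le`). [folklore] -/
theorem harmonic_sub_eq_sum_avgKernel {r : ℕ} (hr : 0 < r) (u : Site 4 → ℝ)
    (hharm : ∀ z : Site 4, (∀ k, |z k| ≤ 4 * (r : ℤ) - 2) → latticeLaplacianZd u z = 0) (j : Fin 4) :
    u (e j) - u 0 = ∑ z ∈ sbox (4 * r), avgKernel r z * (u (z + e j) - u z) := by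
  set v : Site 4 → ℝ := fun z => u (z + e j) - u z with hv
  have hvharm : ∀ z : Site 4, (∀ k, |z k| < 4 * (r : ℤ) - 2) → latticeLaplacianZd v z = 0 := by
    intro z hz
    have e1 : v = (fun z => u (z + e j)) - u := by funext w; simp [hv]
    rw [e1, latticeLaplacianZd_sub, latticeLaplacianZd_comp_add, hharm z fun k => (hz k).le,
      hharm (z + e j) fun k => ?_, sub_zero]
    by_cases hkj : k = j
    · subst hkj; rw [add_e_apply_same]; have := hz k; rw [abs_lt] at this; exact abs_le.2 ⟨by omega, by omega⟩
    · rw [add_e_apply_ne z hkj]; exact (hz k).le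
  have h := harmonic_eq_sum_avgKernel hr v hvharm
  simp only [hv, zero_add] at h
  rw [h]
  exact Finset.sum_congr rfl fun z _ => by ring

end Summit.QuantumFields.YangMills.Cruxes.UVSeamRec.GaussianCalibration

end
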